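import Literature.AlgebraicGeometry.HodgeTheory.RealSl2BlocksProducts
import Literature.AlgebraicGeometry.HodgeTheory.NoTypeIVFactorProductsHodgeConjecture
import HarnessLib

/-!
# `B•((A₁ × A₂)ⁿ) = D•((A₁ × A₂)ⁿ) ⊗ ℂ` and the Hodge conjecture for all powers and mixed powers of a product of two orthogonal real-multiplication varieties of relative dimension one (Hazama 1989; Moonen–Zarhin 1999 Thm. (3.2)(1)) — unconditional

Family `hodge`, layer `Literature/AlgebraicGeometry/HodgeTheory`. Research context: cell `pub-hodge-ring2`
(HONEST FRAMING: research route conditional on HC_CM; not a corollary; Q11.4-sentence-2 already refuted in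
dim ≥ 3), Literature lane, programme R3, part R3-BD (`pub-hodge-ring2-lit-g40/PLAN-R3.md`). UNCONDITIONAL; no
definition, no named fact; no step towards a summit statement beyond the published theorem it formalises. This
file SPECIALISES `RealSl2Blocks` / `RealSl2BlocksProducts` (real `𝔰𝔩₂`-block data, stable under orthogonal products)
to two abelian varieties whose endomorphism algebras are totally real FIELDS of degree `dim`, and derives the
product-lane row of `NoTypeIVFactorProductsHodgeConjecture` / `StablyNondegenerateProducts` without Hazama's fact.

PUBLISHED STATEMENT. Moonen–Zarhin, Duke Math. J. 98 (1999), Thm. (3.2)(1) (= Hazama, Duke Math. J. 58 (1989);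
Gordon's survey Thm. 7.6.2): «Let `X₁` and `X₂` be complex abelian varieties which both satisfy condition (D)
[`Hdg(Xᵏ) = Div(Xᵏ)` for all `k`]. (1) Suppose `X₁` and `X₂` contain no factors of Type 4. Then `X₁ × X₂` again
satisfies (D), and either `Hom(X₁, X₂) ≠ 0` or `Hg(X₁ × X₂) = Hg(X₁) × Hg(X₂)`.» Ribet 1983 Thm. 0 / Hazama 1983
Thm. (1.1): `X` with `End⁰(X)` a totally real field `E` of degree `dim X` satisfies (D).

TREE STATEMENT (`End⁰(A_i) = E_i` totally real fields with `[E_i : ℚ] = dim A_i`, `Hom(A₁, A₂) = 0 = Hom(A₂, A₁)` —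
e.g. `A₁`, `A₂` simple and non-isogenous):
* `hasRealSl2Blocks_prod_of_isTotallyReal` — `A₁ × A₂` has real `𝔰𝔩₂`-block data;
* **`AVSlots.isDivisorGenerated_of_prod_isTotallyReal`** — every abelian variety with slots over `A₁ × A₂` has
  `B• = D• ⊗ ℂ`; **`AbelianVariety.isDivisorGenerated_prod_powSucc_of_isTotallyReal`** (condition (D) for `A₁ × A₂`:
  the conclusion of the named fact `Hazama1989_stablyNondegenerate_prod` ON THIS CLASS, now a theorem;
  `isStablyNondegenerate_prod_of_isTotallyReal`);
* **`hodgeConjectureFor_prod_powSucc_of_isTotallyReal`**, **`hodgeConjectureFor_powSucc_prod_powSucc_of_isTotallyReal`** —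
  the Hodge conjecture for every `(A₁ × A₂)^{N+1}` and every `A₁^{M+1} × A₂^{N+1}`, UNCONDITIONALLY; isogeny closures;
  `…_of_isSimple` variants;
* **the product-lane row without Hazama**: `hodgeConjectureFor_powSucc_prod_powSucc_prod_cmType_of_isTotallyReal_of_cmHodgeHypothesis`
  — HC_CM ∧ Lombardo's span fact ⟹ HC(`(A₁^{M+1} × A₂^{N+1}) × C`) for `C` of CM type (binders `hCM`, `hL` displayed
  exactly as in `NoTypeIVFactorProductsHodgeConjecture`; the first factor is now unconditional).

## References

* [MoonenZarhin1999LowDim] B. Moonen, Yu. Zarhin, Duke Math. J. 98 (1999), §3 Thm. (3.2)(1)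
  [corpus: paper:arxiv-math_9901113 p. 6]. [cite: MoonenZarhin1999LowDim, §3 Thm. (3.2)(1)]
* [Hazama1989] F. Hazama, *Algebraic cycles on nonsimple abelian varieties*, Duke Math. J. 58 (1989).
  [cite: Hazama1989, Thm. (= Gordon 7.6.2)]
* [Gordon1999HodgeAVSurvey] B. B. Gordon, *A survey of the Hodge conjecture for abelian varieties*, Thm. 7.6.2
  [corpus: paper:arxiv-alg-geom_9709030 p. 21]. [cite: Gordon1999HodgeAVSurvey, Thm. 7.6.2]
* [Ribet1983] K. A. Ribet, Amer. J. Math. 105 (1983), Thm. 0–1. [cite: Ribet1983, Thm. 0–1]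
* [Hazama1983] F. Hazama, Tôhoku Math. J. 35 (1983), Thm. (1.1), §3. [cite: Hazama1983, Thm. (1.1) and §3 (pp. 305–306)]
* [vanGeemen1994HodgeAV] B. van Geemen, LNM 1594 (1994), Lemma 3.7. [cite: vanGeemen1994HodgeAV, Lemma 3.7]
* [Lombardo2016] D. Lombardo, Lemma 3.4. [cite: Lombardo2016, Lemma 3.4 (p. 1229)]
-/

noncomputable section

open scoped TensorProduct
open CategoryTheory Module NumberField

namespace Literature.AlgebraicGeometry.HodgeTheory

open Literature.AlgebraicGeometry.Motives (AbelianVariety)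
open Literature.Barriers.HodgeConjecture
open Literature.AlgebraicGeometry.ComplexMultiplication

section ProductPowers

variable {A₁ A₂ B : AbelianVariety ℂ} {n : ℕ} {g : Fin n → (B ⟶ A₁.prod A₂)}

/-- **`A₁ × A₂` has real `𝔰𝔩₂`-block data** for `End⁰(A_i)` totally real fields of degree `dim A_i` and
`Hom(A₁, A₂) = 0 = Hom(A₂, A₁)`. [cite: MoonenZarhin1999LowDim, §3 Thm. (3.2)(1)] [cite: Hazama1983, §3 (pp. 305–306)] -/
theorem hasRealSl2Blocks_prod_of_isTotallyReal (A₁ A₂ : AbelianVariety ℂ)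
    (hF₁ : IsField A₁.endAlgebra) (hF₂ : IsField A₂.endAlgebra)
    [IsTotallyReal (EndField A₁ hF₁)] [IsTotallyReal (EndField A₂ hF₂)]
    (hdeg₁ : Module.finrank ℚ A₁.endAlgebra = A₁.dim) (hdeg₂ : Module.finrank ℚ A₂.endAlgebra = A₂.dim)
    (hAB : ∀ f : A₁ ⟶ A₂, f = 0) (hBA : ∀ f : A₂ ⟶ A₁, f = 0) : HasRealSl2Blocks (A₁.prod A₂) :=
  (hasRealSl2Blocks_of_isTotallyReal A₁ hF₁ hdeg₁).prod (hasRealSl2Blocks_of_isTotallyReal A₂ hF₂ hdeg₂) hAB hBA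

/-- **Theorem (Hazama 1989; Moonen–Zarhin 1999 Thm. (3.2)(1), clause «X₁ × X₂ again satisfies (D)», for the
class of orthogonal real-multiplication varieties of relative dimension one; `B• = D• ⊗ ℂ` for everything with
slots over `A₁ × A₂`).** [cite: MoonenZarhin1999LowDim, §3 Thm. (3.2)(1)] [cite: Hazama1989, Thm. (= Gordon 7.6.2)]
[cite: Ribet1983, Thm. 0–1] [cite: Hazama1983, Thm. (1.1) and §3 (pp. 305–306)] -/
theorem AVSlots.isDivisorGenerated_of_prod_isTotallyReal (hg : AVSlots (A₁.prod A₂) B g)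
    (hF₁ : IsField A₁.endAlgebra) (hF₂ : IsField A₂.endAlgebra)
    [IsTotallyReal (EndField A₁ hF₁)] [IsTotallyReal (EndField A₂ hF₂)]
    (hdeg₁ : Module.finrank ℚ A₁.endAlgebra = A₁.dim) (hdeg₂ : Module.finrank ℚ A₂.endAlgebra = A₂.dim)
    (hAB : ∀ f : A₁ ⟶ A₂, f = 0) (hBA : ∀ f : A₂ ⟶ A₁, f = 0) : IsDivisorGenerated B :=
  (hasRealSl2Blocks_prod_of_isTotallyReal A₁ A₂ hF₁ hF₂ hdeg₁ hdeg₂ hAB hBA).isDivisorGenerated_of_avSlots hg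

/-- **Condition (D) for `A₁ × A₂`: `IsDivisorGenerated ((A₁.prod A₂).powSucc N)` for every `N`** — the conclusion
of `Hazama1989_stablyNondegenerate_prod` (`StablyNondegenerateProducts`) on this class, as a theorem.
[cite: MoonenZarhin1999LowDim, §3 Thm. (3.2)(1)] [cite: Hazama1989, Thm. (= Gordon 7.6.2)] [cite: Gordon1999HodgeAVSurvey, Thm. 7.6.2] -/
theorem AbelianVariety.isDivisorGenerated_prod_powSucc_of_isTotallyReal (A₁ A₂ : AbelianVariety ℂ)
    (hF₁ : IsField A₁.endAlgebra) (hF₂ : IsField A₂.endAlgebra)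
    [IsTotallyReal (EndField A₁ hF₁)] [IsTotallyReal (EndField A₂ hF₂)]
    (hdeg₁ : Module.finrank ℚ A₁.endAlgebra = A₁.dim) (hdeg₂ : Module.finrank ℚ A₂.endAlgebra = A₂.dim)
    (hAB : ∀ f : A₁ ⟶ A₂, f = 0) (hBA : ∀ f : A₂ ⟶ A₁, f = 0) (N : ℕ) :
    IsDivisorGenerated ((A₁.prod A₂).powSucc N) :=
  (hasRealSl2Blocks_prod_of_isTotallyReal A₁ A₂ hF₁ hF₂ hdeg₁ hdeg₂ hAB hBA).isDivisorGenerated_powSucc N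

/-- `A₁ × A₂` itself: `B•(A₁ × A₂) = D•(A₁ × A₂) ⊗ ℂ`. [cite: MoonenZarhin1999LowDim, §3 Thm. (3.2)(1)] -/
theorem AbelianVariety.isDivisorGenerated_prod_of_isTotallyReal (A₁ A₂ : AbelianVariety ℂ)
    (hF₁ : IsField A₁.endAlgebra) (hF₂ : IsField A₂.endAlgebra)
    [IsTotallyReal (EndField A₁ hF₁)] [IsTotallyReal (EndField A₂ hF₂)]
    (hdeg₁ : Module.finrank ℚ A₁.endAlgebra = A₁.dim) (hdeg₂ : Module.finrank ℚ A₂.endAlgebra = A₂.dim)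
    (hAB : ∀ f : A₁ ⟶ A₂, f = 0) (hBA : ∀ f : A₂ ⟶ A₁, f = 0) :
    IsDivisorGenerated (A₁.prod A₂) :=
  AbelianVariety.isDivisorGenerated_prod_powSucc_of_isTotallyReal A₁ A₂ hF₁ hF₂ hdeg₁ hdeg₂ hAB hBA 0

/-- **`A₁ × A₂` is STABLY NONDEGENERATE** (`IsStablyNondegenerate`, Gordon Thm. 7.5 (1)/Def. 7.6 = Moonen–Zarhin
condition (D)). [cite: MoonenZarhin1999LowDim, §2 condition (D) and §3 Thm. (3.2)(1)]
[cite: Gordon1999HodgeAVSurvey, Thm. 7.5, Def. 7.6 and Thm. 7.6.2] [cite: Hazama1989, Thm. (= Gordon 7.6.2)] -/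
theorem isStablyNondegenerate_prod_of_isTotallyReal (A₁ A₂ : AbelianVariety ℂ)
    (hF₁ : IsField A₁.endAlgebra) (hF₂ : IsField A₂.endAlgebra)
    [IsTotallyReal (EndField A₁ hF₁)] [IsTotallyReal (EndField A₂ hF₂)]
    (hdeg₁ : Module.finrank ℚ A₁.endAlgebra = A₁.dim) (hdeg₂ : Module.finrank ℚ A₂.endAlgebra = A₂.dim)
    (hAB : ∀ f : A₁ ⟶ A₂, f = 0) (hBA : ∀ f : A₂ ⟶ A₁, f = 0) :
    IsStablyNondegenerate (A₁.prod A₂) :=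
  (hasRealSl2Blocks_prod_of_isTotallyReal A₁ A₂ hF₁ hF₂ hdeg₁ hdeg₂ hAB hBA).isStablyNondegenerate

/-- **The Hodge conjecture for every power `(A₁ × A₂)^{N+1}` — UNCONDITIONAL.** [cite: MoonenZarhin1999LowDim, §3 Thm. (3.2)(1)]
[cite: Hazama1989, Thm. (= Gordon 7.6.2)] [cite: Ribet1983, Thm. 0–1] -/
theorem hodgeConjectureFor_prod_powSucc_of_isTotallyReal (A₁ A₂ : AbelianVariety ℂ)
    (hF₁ : IsField A₁.endAlgebra) (hF₂ : IsField A₂.endAlgebra)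
    (hT₁ : IsTotallyReal (EndField A₁ hF₁)) (hT₂ : IsTotallyReal (EndField A₂ hF₂))
    (hdeg₁ : Module.finrank ℚ A₁.endAlgebra = A₁.dim) (hdeg₂ : Module.finrank ℚ A₂.endAlgebra = A₂.dim)
    (hAB : ∀ f : A₁ ⟶ A₂, f = 0) (hBA : ∀ f : A₂ ⟶ A₁, f = 0) (N : ℕ) :
    HodgeConjectureFor ((A₁.prod A₂).powSucc N).dim ((A₁.prod A₂).powSucc N).X :=
  haveI := hT₁
  haveI := hT₂
  (hasRealSl2Blocks_prod_of_isTotallyReal A₁ A₂ hF₁ hF₂ hdeg₁ hdeg₂ hAB hBA).hodgeConjectureFor_powSucc N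

/-- The Hodge conjecture for everything isogenous to a power of `A₁ × A₂`. [cite: vanGeemen1994HodgeAV, Lemma 3.7]
[cite: MoonenZarhin1999LowDim, §3 Thm. (3.2)(1)] -/
theorem hodgeConjectureFor_of_isIsogenous_prod_powSucc_of_isTotallyReal {A₁ A₂ X : AbelianVariety ℂ}
    (hF₁ : IsField A₁.endAlgebra) (hF₂ : IsField A₂.endAlgebra)
    (hT₁ : IsTotallyReal (EndField A₁ hF₁)) (hT₂ : IsTotallyReal (EndField A₂ hF₂))
    (hdeg₁ : Module.finrank ℚ A₁.endAlgebra = A₁.dim) (hdeg₂ : Module.finrank ℚ A₂.endAlgebra = A₂.dim)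
    (hAB : ∀ f : A₁ ⟶ A₂, f = 0) (hBA : ∀ f : A₂ ⟶ A₁, f = 0) {N : ℕ}
    (hX : X.IsIsogenous ((A₁.prod A₂).powSucc N)) :
    HodgeConjectureFor X.dim X.X :=
  HodgeConjectureFor.of_isIsogenous hX
    (hodgeConjectureFor_prod_powSucc_of_isTotallyReal A₁ A₂ hF₁ hF₂ hT₁ hT₂ hdeg₁ hdeg₂ hAB hBA N)

/-! ### Mixed powers `A₁^{M+1} × A₂^{N+1}` -/

/-- **`B•(A₁^{M+1} × A₂^{N+1}) = D• ⊗ ℂ` for all `M`, `N`.** [cite: MoonenZarhin1999LowDim, §3 Thm. (3.2)(1)]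
[cite: Hazama1989, Thm. (= Gordon 7.6.2)] [cite: vanGeemen1994HodgeAV, §2.4–2.5 (p. 235) and §3.6–3.7 (p. 236)] -/
theorem AbelianVariety.isDivisorGenerated_powSucc_prod_powSucc_of_isTotallyReal (A₁ A₂ : AbelianVariety ℂ)
    (hF₁ : IsField A₁.endAlgebra) (hF₂ : IsField A₂.endAlgebra)
    [IsTotallyReal (EndField A₁ hF₁)] [IsTotallyReal (EndField A₂ hF₂)]
    (hdeg₁ : Module.finrank ℚ A₁.endAlgebra = A₁.dim) (hdeg₂ : Module.finrank ℚ A₂.endAlgebra = A₂.dim)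
    (hAB : ∀ f : A₁ ⟶ A₂, f = 0) (hBA : ∀ f : A₂ ⟶ A₁, f = 0) (M N : ℕ) :
    IsDivisorGenerated ((A₁.powSucc M).prod (A₂.powSucc N)) :=
  (hasRealSl2Blocks_of_isTotallyReal A₁ hF₁ hdeg₁).isDivisorGenerated_powSucc_prod_powSucc
    (hasRealSl2Blocks_of_isTotallyReal A₂ hF₂ hdeg₂) hAB hBA M N

/-- **The Hodge conjecture for every `A₁^{M+1} × A₂^{N+1}` — UNCONDITIONAL.** [cite: MoonenZarhin1999LowDim, §3 Thm. (3.2)(1)]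
[cite: Hazama1989, Thm. (= Gordon 7.6.2)] [cite: Ribet1983, Thm. 0–1] -/
theorem hodgeConjectureFor_powSucc_prod_powSucc_of_isTotallyReal (A₁ A₂ : AbelianVariety ℂ)
    (hF₁ : IsField A₁.endAlgebra) (hF₂ : IsField A₂.endAlgebra)
    (hT₁ : IsTotallyReal (EndField A₁ hF₁)) (hT₂ : IsTotallyReal (EndField A₂ hF₂))
    (hdeg₁ : Module.finrank ℚ A₁.endAlgebra = A₁.dim) (hdeg₂ : Module.finrank ℚ A₂.endAlgebra = A₂.dim)
    (hAB : ∀ f : A₁ ⟶ A₂, f = 0) (hBA : ∀ f : A₂ ⟶ A₁, f = 0) (M N : ℕ) :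
    HodgeConjectureFor ((A₁.powSucc M).prod (A₂.powSucc N)).dim ((A₁.powSucc M).prod (A₂.powSucc N)).X :=
  haveI := hT₁
  haveI := hT₂
  (hasRealSl2Blocks_of_isTotallyReal A₁ hF₁ hdeg₁).hodgeConjectureFor_powSucc_prod_powSucc
    (hasRealSl2Blocks_of_isTotallyReal A₂ hF₂ hdeg₂) hAB hBA M N

/-- The Hodge conjecture for everything isogenous to some `A₁^{M+1} × A₂^{N+1}`. [cite: vanGeemen1994HodgeAV, Lemma 3.7]
[cite: MoonenZarhin1999LowDim, §3 Thm. (3.2)(1)] -/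
theorem hodgeConjectureFor_of_isIsogenous_powSucc_prod_powSucc_of_isTotallyReal {A₁ A₂ X : AbelianVariety ℂ}
    (hF₁ : IsField A₁.endAlgebra) (hF₂ : IsField A₂.endAlgebra)
    (hT₁ : IsTotallyReal (EndField A₁ hF₁)) (hT₂ : IsTotallyReal (EndField A₂ hF₂))
    (hdeg₁ : Module.finrank ℚ A₁.endAlgebra = A₁.dim) (hdeg₂ : Module.finrank ℚ A₂.endAlgebra = A₂.dim)
    (hAB : ∀ f : A₁ ⟶ A₂, f = 0) (hBA : ∀ f : A₂ ⟶ A₁, f = 0) {M N : ℕ}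
    (hX : X.IsIsogenous ((A₁.powSucc M).prod (A₂.powSucc N))) :
    HodgeConjectureFor X.dim X.X :=
  HodgeConjectureFor.of_isIsogenous hX
    (hodgeConjectureFor_powSucc_prod_powSucc_of_isTotallyReal A₁ A₂ hF₁ hF₂ hT₁ hT₂ hdeg₁ hdeg₂ hAB hBA M N)

/-! ### Simple, non-isogenous factors -/

/-- **Simple non-isogenous factors** (`Hom = 0` both ways by `orthogonal_of_isSimple_of_not_isIsogenous₂`): the Hodge
conjecture for all `A₁^{M+1} × A₂^{N+1}`. [cite: MoonenZarhin1999LowDim, §3 Thm. (3.2)(1)] [cite: Hazama1989, Thm. (= Gordon 7.6.2)] -/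
theorem hodgeConjectureFor_powSucc_prod_powSucc_of_isTotallyReal_of_isSimple (A₁ A₂ : AbelianVariety ℂ)
    (hF₁ : IsField A₁.endAlgebra) (hF₂ : IsField A₂.endAlgebra)
    (hT₁ : IsTotallyReal (EndField A₁ hF₁)) (hT₂ : IsTotallyReal (EndField A₂ hF₂))
    (hdeg₁ : Module.finrank ℚ A₁.endAlgebra = A₁.dim) (hdeg₂ : Module.finrank ℚ A₂.endAlgebra = A₂.dim)
    (h₁ : A₁.IsSimple) (h₂ : A₂.IsSimple) (h₁₂ : ¬ AbelianVariety.IsIsogenous A₁ A₂) (M N : ℕ) :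
    HodgeConjectureFor ((A₁.powSucc M).prod (A₂.powSucc N)).dim ((A₁.powSucc M).prod (A₂.powSucc N)).X :=
  hodgeConjectureFor_powSucc_prod_powSucc_of_isTotallyReal A₁ A₂ hF₁ hF₂ hT₁ hT₂ hdeg₁ hdeg₂
    (orthogonal_of_isSimple_of_not_isIsogenous₂ h₁ h₂ h₁₂).1 (orthogonal_of_isSimple_of_not_isIsogenous₂ h₁ h₂ h₁₂).2 M N

/-- Simple non-isogenous factors: `A₁ × A₂` is stably nondegenerate. [cite: MoonenZarhin1999LowDim, §3 Thm. (3.2)(1)]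
[cite: Gordon1999HodgeAVSurvey, Thm. 7.6.2] -/
theorem isStablyNondegenerate_prod_of_isTotallyReal_of_isSimple (A₁ A₂ : AbelianVariety ℂ)
    (hF₁ : IsField A₁.endAlgebra) (hF₂ : IsField A₂.endAlgebra)
    [IsTotallyReal (EndField A₁ hF₁)] [IsTotallyReal (EndField A₂ hF₂)]
    (hdeg₁ : Module.finrank ℚ A₁.endAlgebra = A₁.dim) (hdeg₂ : Module.finrank ℚ A₂.endAlgebra = A₂.dim)
    (h₁ : A₁.IsSimple) (h₂ : A₂.IsSimple) (h₁₂ : ¬ AbelianVariety.IsIsogenous A₁ A₂) :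
    IsStablyNondegenerate (A₁.prod A₂) :=
  isStablyNondegenerate_prod_of_isTotallyReal A₁ A₂ hF₁ hF₂ hdeg₁ hdeg₂
    (orthogonal_of_isSimple_of_not_isIsogenous₂ h₁ h₂ h₁₂).1 (orthogonal_of_isSimple_of_not_isIsogenous₂ h₁ h₂ h₁₂).2

/-! ### The product-lane row `(A₁^{M+1} × A₂^{N+1}) × C`, `C` of CM type, WITHOUT Hazama's fact -/

/-- **HC_CM ∧ Lombardo ⟹ HC(`(A₁^{M+1} × A₂^{N+1}) × C`)** for two orthogonal real-multiplication varieties of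
relative dimension one and `C` of CM type: the row
`StablyNondegenerateProducts.hodgeConjectureFor_powSucc_prod_powSucc_prod_cmType_of_isTotallyReal_of_hazama_of_cmHodgeHypothesis`
with its binder `hH : Hazama1989_stablyNondegenerate_prod` DISCHARGED. Binders displayed: `hCM` (HC for CM abelian
varieties, Milne's per-variety form), `hL` (`Lombardo2016_hodgeClassesProductSpan`).
[cite: MoonenZarhin1999LowDim, §1 and §3 Thm. (3.2)] [cite: Lombardo2016, Lemma 3.4 (p. 1229)] -/
theorem hodgeConjectureFor_powSucc_prod_powSucc_prod_cmType_of_isTotallyReal_of_cmHodgeHypothesis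
    (hCM : ∀ B : AbelianVariety ℂ, Milne1999.CMHodgeHypothesisAt B)
    (hL : Lombardo2016_hodgeClassesProductSpan) (A₁ A₂ C : AbelianVariety ℂ)
    (hF₁ : IsField A₁.endAlgebra) (hF₂ : IsField A₂.endAlgebra)
    (hT₁ : IsTotallyReal (EndField A₁ hF₁)) (hT₂ : IsTotallyReal (EndField A₂ hF₂))
    (hdeg₁ : Module.finrank ℚ A₁.endAlgebra = A₁.dim) (hdeg₂ : Module.finrank ℚ A₂.endAlgebra = A₂.dim)
    (hAB : ∀ f : A₁ ⟶ A₂, f = 0) (hBA : ∀ f : A₂ ⟶ A₁, f = 0) (hCt : Milne1999.IsOfCMType C) (M N : ℕ) :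
    HodgeConjectureFor (((A₁.powSucc M).prod (A₂.powSucc N)).prod C).dim
      (((A₁.powSucc M).prod (A₂.powSucc N)).prod C).X :=
  haveI := hT₁
  haveI := hT₂
  hodgeConjectureFor_powSucc_prod_powSucc_prod_of_cmHodgeHypothesis hCM hL A₁ A₂ C
    (hasNoTypeIVFactor_of_isTotallyReal A₁ hF₁) (hasNoTypeIVFactor_of_isTotallyReal A₂ hF₂) hCt M N
    (hodgeConjectureFor_powSucc_prod_powSucc_of_isTotallyReal A₁ A₂ hF₁ hF₂ hT₁ hT₂ hdeg₁ hdeg₂ hAB hBA M N)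

/-- The same for everything isogenous to `(A₁^{M+1} × A₂^{N+1}) × C`. [cite: vanGeemen1994HodgeAV, Lemma 3.7]
[cite: MoonenZarhin1999LowDim, §3 Thm. (3.2)] -/
theorem hodgeConjectureFor_of_isIsogenous_powSucc_prod_powSucc_prod_cmType_of_isTotallyReal_of_cmHodgeHypothesis
    (hCM : ∀ B : AbelianVariety ℂ, Milne1999.CMHodgeHypothesisAt B)
    (hL : Lombardo2016_hodgeClassesProductSpan) {A₁ A₂ C X : AbelianVariety ℂ}
    (hF₁ : IsField A₁.endAlgebra) (hF₂ : IsField A₂.endAlgebra)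
    (hT₁ : IsTotallyReal (EndField A₁ hF₁)) (hT₂ : IsTotallyReal (EndField A₂ hF₂))
    (hdeg₁ : Module.finrank ℚ A₁.endAlgebra = A₁.dim) (hdeg₂ : Module.finrank ℚ A₂.endAlgebra = A₂.dim)
    (hAB : ∀ f : A₁ ⟶ A₂, f = 0) (hBA : ∀ f : A₂ ⟶ A₁, f = 0) (hCt : Milne1999.IsOfCMType C) {M N : ℕ}
    (hX : X.IsIsogenous (((A₁.powSucc M).prod (A₂.powSucc N)).prod C)) :
    HodgeConjectureFor X.dim X.X :=
  HodgeConjectureFor.of_isIsogenous hX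
    (hodgeConjectureFor_powSucc_prod_powSucc_prod_cmType_of_isTotallyReal_of_cmHodgeHypothesis hCM hL A₁ A₂ C
      hF₁ hF₂ hT₁ hT₂ hdeg₁ hdeg₂ hAB hBA hCt M N)

end ProductPowers

end Literature.AlgebraicGeometry.HodgeTheory

end
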